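import Summits.ValiantsHypothesis.ValiantsHypothesis.Theses.ShallowShadows
import Literature.Computability.Complexity.MonotoneMatchingDepth

/-!
# Birth skeleton — crux `RazWigdersonMatching` (item `stmt-ValiantsHypothesis-17127`), route `ShallowShadows`, line `birth`

Crux (route `route-ValiantsHypothesis-ShallowShadows`, the FAR SIDE of the shadow transfer):
`Summit.ValiantsHypothesis.ValiantsHypothesis.Theses.ShallowShadows.RazWigdersonMatching` —
`∃ c > 0, ∃ m₀, ∀ m ≥ m₀, 2 ^ (c·m) ≤ formulaSizeOver monotoneBasis (perfectMatchingFn m)`: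
monotone formulas for bipartite perfect matching on `K_{m,m}` have size `2^{Ω(m)}`
(Raz–Wigderson, STOC 1990 / J. ACM 39 (1992), Thm. 4.2 + formula balancing; printed in this
form in Cavalar–Göös–Riazanov–Sofronova–Sokolov, arXiv:2507.16105 §1.2; Jukna 2012, Cor. 7.27
for the non-bipartite `MATCH_n`).

Line = the printed proof, cut at its two published joints plus the non-vacuity witness
(three named stubs, composed by `RazWigdersonMatching_of`):

* `stub_depth` = `BPMMonotoneDepth` — RAZ–WIGDERSON Thm. 4.2 in DEPTH form: `∃ c > 0, ∃ n₀,
  ∀ n ≥ n₀`, every `{∧₂, ∨₂}`-circuit computing `perfectMatchingFn n` has depth `≥ c·n`.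
  Literally the Literature named fact `Literature.Computability.Complexity.RazWigderson1992_bpm_monotoneDepth`
  (wiring `example` below, `rfl`). Proof in print: Karchmer–Wigderson games (monotone depth =
  CC of the monotone KW relation; only the easy direction "depth-`d` circuit ⇒ `d`-bit protocol"
  is needed) + the `Ω(n)` randomized CC of DISJOINTNESS (Kalyanasundaram–Schnitger; Razborov
  1990) through RW's Main Theorem (`MATCH` on `3m` vertices) and the vertex-duplication reduction
  of Thm. 4.2. Foreseen layer-2 split for the lead (not filed here; the tree has no two-party
  deterministic/randomized protocol type yet — `NOFProtocol` and `AlgKWProtocol` are the nearest):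
  (KW-easy) `depth C ≥ D^cc(mKW_f)`; (RW Main) `R^cc_{1/3}(DISJ_m) ≤ O(D^cc(mKW_{PM_{3m}}))`;
  (KS) `R^cc(DISJ_m) = Ω(m)`. [published theorem; size XL]
* `stub_balancing` = `MonotoneFormulaBalancing` — FORMULA BALANCING LEMMA, monotone form (Spira
  1971; Brent–Kuck–Maruyama 1973; Jukna 2012, Lemma 6.1): an absolute `c > 0` such that every
  `{∧₂, ∨₂}`-formula `F` is equivalent to a `{∧₂, ∨₂}`-formula of depth `≤ c·log₂(F.size + 1)`.
  Literally the Literature named fact `Literature.Computability.Complexity.monotoneFormula_balancing`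
  (wiring `example`, `rfl`). In the tree's straight-line model this needs: extraction of the
  sub-formula feeding the output (≤ `F.size + 1` leaves), the `1/3–2/3` separator sub-formula `G`,
  the monotone recombination `F ≡ (G ∧ F[G:=1]) ∨ F[G:=0]` with constant elimination inside
  `{∧, ∨}` (a `{∧,∨}`-formula of variables is never constant; `F[G:=1] ≡ 1` / `F[G:=0] ≡ 0`
  collapse to `G ∨ F[G:=0]` / `G ∧ F[G:=1]`), and the recursion. [published lemma; size L]
* `stub_formulaExists` = `BPMMonotoneFormulaExists` — NON-VACUITY: for `m ≥ 1`,
  `perfectMatchingFn m` is computed by some `{∧₂, ∨₂}`-formula (its monotone DNF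
  `⋁_σ ⋀ᵢ x_{i,σ i}`, via `Circuit.bigOr`/`Circuit.bigAnd` of
  `Literature/Computability/Complexity/FormulaComposition.lean`), so that
  `formulaSizeOver monotoneBasis (perfectMatchingFn m)` is an attained minimum and not the junk
  value `0` (for `m = 0` no gate-free/constant-free circuit exists over the empty variable type,
  the value IS junk `0`, whence `1 ≤ m`). [folklore; size S–M; provable now]

`RazWigdersonMatching_of : Registered.stub_depth → Registered.stub_balancing →
Registered.stub_formulaExists → RazWigdersonMatching` is the real (sorry-free) composition,
exactly Jukna's Cor. 7.27 argument: for `m ≥ m₀ := max n₀ (max 1 ⌈1/c⌉₊)`, `c := c₁/(2c₂)`,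
the infimum `s = formulaSizeOver …` is attained by a formula `F` (stub 3), balanced to `F'` of
depth `≤ c₂ log₂(s+1)` computing the same function (stub 2), so `c₁ m ≤ c₂ log₂(s+1)` (stub 1),
i.e. `2^{2cm} ≤ s + 1`, and `2^{cm} ≤ 2^{2cm} − 1 ≤ s` because `2^{cm} ≥ 2`.
The `Registered.stub_…` aliases are the device of `Cruxes/RestorationQP/Lines/birth.lean` /
`Cruxes/TameNF/Lines/birth.lean` (hypotheses of the composition admissible iff declared stubs BY
NAME).

Disproof used: none — `ledger crux ls stmt-ValiantsHypothesis-17127` shows no workfiles (no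
`Disproof.lean`, no `_false_without_` theorem, no landed `Negative/` lemma) at registration
time; `ledger negatives --problem ValiantsHypothesis` has nothing on monotone Boolean
depth/formula size. The crux is a published theorem (grounder: KNOWN, p130062; refuter
page-check: RW STOC 1990 p. 13 Thm. 4.2), so the only risk is formalisation size, concentrated
in `stub_depth`.
-/

set_option linter.dupNamespace false

namespace Summit.ValiantsHypothesis.ValiantsHypothesis.Cruxes.RazWigdersonMatching.Birth

open Literature.Computability.Complexity
open Literature.Barriers.PneNP (perfectMatchingFn)
open Summit.ValiantsHypothesis.ValiantsHypothesis.Theses.ShallowShadows (RazWigdersonMatching)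

/-! ## The three stub statements -/

/-- RAZ–WIGDERSON, Thm. 4.2 (depth form): there is `c > 0` such that for all large `n` every
monotone fan-in-2 circuit (basis `{∧₂, ∨₂}`) computing the bipartite perfect matching function
`perfectMatchingFn n` has depth at least `c · n` ("`d_m(BPM) = Ω(n)`"). Verbatim the Literature
named fact `RazWigderson1992_bpm_monotoneDepth`. [published: RazWigderson1990 Thm. 4.2 (p. 13);
RazWigderson1992 Thm. 4.2; Jukna2012 Thm. 7.26 — size XL] -/
def BPMMonotoneDepth : Prop :=
  ∃ c : ℝ, 0 < c ∧ ∃ n₀ : ℕ, ∀ n ≥ n₀, ∀ C : Circuit (Fin n × Fin n),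
    C.IsOver monotoneBasis → C.Computes (perfectMatchingFn n) → c * n ≤ (C.depth : ℝ)

/-- FORMULA BALANCING LEMMA, monotone form: an absolute `c > 0` such that every
`{∧₂, ∨₂}`-formula `F` is equivalent to a `{∧₂, ∨₂}`-formula of depth at most
`c · log₂ (F.size + 1)`. Verbatim the Literature named fact `monotoneFormula_balancing`.
[published: Spira 1971; Brent–Kuck–Maruyama 1973; Jukna2012 Lemma 6.1 — size L] -/
def MonotoneFormulaBalancing : Prop :=
  ∃ c : ℝ, 0 < c ∧ ∀ (ι : Type) (F : Circuit ι), F.IsOver monotoneBasis → F.IsFormula →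
    ∃ F' : Circuit ι, F'.IsOver monotoneBasis ∧ F'.IsFormula ∧ (∀ x, F'.eval x = F.eval x) ∧
      (F'.depth : ℝ) ≤ c * Real.logb 2 (F.size + 1)

/-- NON-VACUITY: for `m ≥ 1` the bipartite perfect matching function has SOME monotone formula
(its monotone DNF `⋁_σ ⋀ᵢ x_{i,σ i}`), so `formulaSizeOver monotoneBasis (perfectMatchingFn m)`
is an attained minimum. [folklore; Jukna2012 §1.1 — size S–M, provable now with
`Circuit.bigOr` / `Circuit.bigAnd` of `FormulaComposition.lean`] -/
def BPMMonotoneFormulaExists : Prop :=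
  ∀ m : ℕ, 1 ≤ m → ∃ F : Circuit (Fin m × Fin m),
    F.IsOver monotoneBasis ∧ F.IsFormula ∧ F.Computes (perfectMatchingFn m)

/-- Wiring check: stub 1 is the Literature fact `RazWigderson1992_bpm_monotoneDepth` verbatim. -/
example : BPMMonotoneDepth = RazWigderson1992_bpm_monotoneDepth := rfl

/-- Wiring check: stub 2 is the Literature fact `monotoneFormula_balancing` verbatim. -/
example : MonotoneFormulaBalancing = monotoneFormula_balancing := rfl

/-! ## Registered stubs (signatures = the statements above, verbatim) -/

/-- STUB `stub_depth` (signature = `BPMMonotoneDepth` verbatim): Raz–Wigderson Thm. 4.2, monotone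
depth `Ω(n)` for bipartite perfect matching. [published; KW games + randomized CC of
disjointness — size XL] -/
theorem stub_depth :
    ∃ c : ℝ, 0 < c ∧ ∃ n₀ : ℕ, ∀ n ≥ n₀, ∀ C : Circuit (Fin n × Fin n),
      C.IsOver monotoneBasis → C.Computes (perfectMatchingFn n) → c * n ≤ (C.depth : ℝ) := by
  sorry

/-- STUB `stub_balancing` (signature = `MonotoneFormulaBalancing` verbatim): the monotone Formula
Balancing Lemma in the straight-line model. [published; Spira/Brent restructuring — size L] -/
theorem stub_balancing :
    ∃ c : ℝ, 0 < c ∧ ∀ (ι : Type) (F : Circuit ι), F.IsOver monotoneBasis → F.IsFormula →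
      ∃ F' : Circuit ι, F'.IsOver monotoneBasis ∧ F'.IsFormula ∧ (∀ x, F'.eval x = F.eval x) ∧
        (F'.depth : ℝ) ≤ c * Real.logb 2 (F.size + 1) := by
  sorry

/-- STUB `stub_formulaExists` (signature = `BPMMonotoneFormulaExists` verbatim): the monotone DNF
of `perfectMatchingFn m`, `m ≥ 1`, as a `{∧₂, ∨₂}`-formula. [folklore — size S–M] -/
theorem stub_formulaExists :
    ∀ m : ℕ, 1 ≤ m → ∃ F : Circuit (Fin m × Fin m),
      F.IsOver monotoneBasis ∧ F.IsFormula ∧ F.Computes (perfectMatchingFn m) := by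
  sorry

/-! ## Name-keyed aliases of the stub statements (hypotheses of the composition) -/
namespace Registered

/-- Alias of `BPMMonotoneDepth` (= the signature of `stub_depth`). -/
abbrev stub_depth : Prop := BPMMonotoneDepth
/-- Alias of `MonotoneFormulaBalancing` (= the signature of `stub_balancing`). -/
abbrev stub_balancing : Prop := MonotoneFormulaBalancing
/-- Alias of `BPMMonotoneFormulaExists` (= the signature of `stub_formulaExists`). -/
abbrev stub_formulaExists : Prop := BPMMonotoneFormulaExists

end Registered

/-! ## Composition (kernel-checked, sorry-free) -/

/-- **Composition** (Jukna 2012, Cor. 7.27 argument, kernel-checked): depth `Ω(m)` + balancing +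
non-vacuity ⇒ monotone formula size `2^{Ω(m)}`. With `c := c₁ / (2 c₂)` and
`m₀ := max n₀ (max 1 ⌈1/c⌉₊)`: the attained minimum `s` is balanced to depth `≤ c₂ log₂(s+1)`,
so `c₁ m ≤ c₂ log₂ (s+1)`, `2^{2cm} ≤ s+1`, and `2^{cm} ≤ 2^{2cm} - 1 ≤ s` as `2^{cm} ≥ 2`.
Concludes the crux `Summit.ValiantsHypothesis.ValiantsHypothesis.Theses.ShallowShadows.RazWigdersonMatching`
BY NAME. [Jukna2012, Cor. 7.27; CavalarEtAl2026 §1.2] -/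
theorem RazWigdersonMatching_of :
    Registered.stub_depth → Registered.stub_balancing → Registered.stub_formulaExists →
      RazWigdersonMatching := by
  rintro ⟨c₁, hc₁, n₀, hdepth⟩ ⟨c₂, hc₂, hbal⟩ hex
  have hc : 0 < c₁ / (2 * c₂) := by positivity
  refine ⟨c₁ / (2 * c₂), hc, max n₀ (max 1 ⌈1 / (c₁ / (2 * c₂))⌉₊), ?_⟩
  intro m hm
  have hmn₀ : n₀ ≤ m := le_trans (le_max_left _ _) hm
  have hm1 : 1 ≤ m := le_trans (le_trans (le_max_left _ _) (le_max_right _ _)) hm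
  have hmc : ⌈1 / (c₁ / (2 * c₂))⌉₊ ≤ m :=
    le_trans (le_trans (le_max_right _ _) (le_max_right _ _)) hm
  -- the infimum defining `formulaSizeOver` is attained (stub 3)
  have hSne : {s | ∃ C : Circuit (Fin m × Fin m), C.IsOver monotoneBasis ∧ C.IsFormula ∧
      C.Computes (perfectMatchingFn m) ∧ C.size = s}.Nonempty := by
    obtain ⟨F, hF₁, hF₂, hF₃⟩ := hex m hm1
    exact ⟨F.size, F, hF₁, hF₂, hF₃, rfl⟩
  obtain ⟨F, hFover, hFformula, hFcomp, hFsize⟩ := Nat.sInf_mem hSne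
  have hfs : formulaSizeOver monotoneBasis (perfectMatchingFn m) = F.size := by
    unfold formulaSizeOver
    exact hFsize.symm
  -- balance the minimal formula (stub 2); the balanced formula computes the same function
  obtain ⟨F', hF'over, -, hF'eval, hF'depth⟩ := hbal (Fin m × Fin m) F hFover hFformula
  have hF'comp : F'.Computes (perfectMatchingFn m) := fun x => (hF'eval x).trans (hFcomp x)
  -- depth lower bound (stub 1)
  have hd : c₁ * m ≤ (F'.depth : ℝ) := hdepth m hmn₀ F' hF'over hF'comp
  have hlog : c₁ * m ≤ c₂ * Real.logb 2 (F.size + 1) := hd.trans hF'depth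
  -- hence `2 c m ≤ log₂ (s + 1)` and `2 ^ (2 c m) ≤ s + 1`
  have h2cm : 2 * (c₁ / (2 * c₂)) * m ≤ Real.logb 2 ((F.size : ℝ) + 1) := by
    have h1 : 2 * (c₁ / (2 * c₂)) * m = (c₁ * m) / c₂ := by
      field_simp
    rw [h1, div_le_iff₀ hc₂]
    linarith [hlog]
  have hpos : (0 : ℝ) < (F.size : ℝ) + 1 := by positivity
  have hpow : (2 : ℝ) ^ (2 * (c₁ / (2 * c₂)) * m) ≤ (F.size : ℝ) + 1 :=
    (Real.le_logb_iff_rpow_le one_lt_two hpos).1 h2cm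
  -- `c m ≥ 1`, so `y := 2 ^ (c m) ≥ 2` and `y ≤ y² - 1 ≤ s`
  have hcm1 : 1 ≤ (c₁ / (2 * c₂)) * m := by
    have h1 : 1 / (c₁ / (2 * c₂)) ≤ ⌈1 / (c₁ / (2 * c₂))⌉₊ := Nat.le_ceil _
    have h2 : (⌈1 / (c₁ / (2 * c₂))⌉₊ : ℝ) ≤ m := by exact_mod_cast hmc
    have h3 : 1 / (c₁ / (2 * c₂)) ≤ m := h1.trans h2
    rw [div_le_iff₀ hc] at h3
    linarith [h3]
  have hy2 : (2 : ℝ) ≤ 2 ^ ((c₁ / (2 * c₂)) * m) := by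
    calc (2 : ℝ) = 2 ^ (1 : ℝ) := (Real.rpow_one 2).symm
      _ ≤ 2 ^ ((c₁ / (2 * c₂)) * m) := Real.rpow_le_rpow_of_exponent_le one_le_two hcm1
  have hsq : (2 : ℝ) ^ (2 * (c₁ / (2 * c₂)) * m) =
      (2 : ℝ) ^ ((c₁ / (2 * c₂)) * m) * (2 : ℝ) ^ ((c₁ / (2 * c₂)) * m) := by
    rw [← Real.rpow_add two_pos]
    ring_nf
  rw [hfs]
  have key : (2 : ℝ) ^ ((c₁ / (2 * c₂)) * m) ≤ (F.size : ℝ) := by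
    nlinarith [hpow, hy2, hsq]
  exact_mod_cast key

/-- Wiring check: the registered stubs feed `RazWigdersonMatching_of` exactly as stated (the
inline stub signatures are the alias statements verbatim), so the skeleton is
`RazWigdersonMatching` closed modulo the three stubs (sorries enter only through them). -/
example : RazWigdersonMatching :=
  RazWigdersonMatching_of stub_depth stub_balancing stub_formulaExists

/-- Wiring check: the two published stubs are closed by the Literature facts once those are
proved (`_holds`), with no further glue. -/
example (h₁ : RazWigderson1992_bpm_monotoneDepth) (h₂ : monotoneFormula_balancing)
    (h₃ : BPMMonotoneFormulaExists) : RazWigdersonMatching :=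
  RazWigdersonMatching_of h₁ h₂ h₃

end Summit.ValiantsHypothesis.ValiantsHypothesis.Cruxes.RazWigdersonMatching.Birth
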